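import Literature.Topology.FourManifolds.HandleAttachingMapsAssoc
import HarnessLib

/-!
# Transport of multi-attachment data along a diffeomorphism of the attached manifold

Topic `Literature/Topology/FourManifolds`; a small plumbing file below
`HandleAttachingMapsAssoc.lean` (Kosinski's simultaneous attachment of handles,
`HandleAttachingMap.MultiAttachmentData h IP P`: the embedding `jA` of `M ∖ ⋃ h̄ᵢ(S)`, the handle
embeddings `jBᵢ`, covering `P`, glued along `x ∼ h̄ᵢ α(x)`).  Whereas
`HandleAttachingMapsTransport.lean` moves the ATTACHING MAPS by a diffeomorphism of `M`, here the
TARGET moves: **if `P` is `M` with handles attached along the `h̄ᵢ` (data `D`) and `e : P ≅ P'`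
is a diffeomorphism, then so is `P'`, with data `e ∘ jA`, `e ∘ jBᵢ`** (`MultiAttachmentData.map`;
Kosinski 1993, VI §6: the attached manifold is defined up to such diffeomorphisms).  Everything
is proved; one definition (`map`), no named fact.

Use: the Stein models `X₀ ≅ Base g` of the handle-free base case of
`Literature.Geometry.Symplectic.palf_stein_supportedByBoundaryOpenBook`
(`LefschetzBaseModelStein.lean`, `LefschetzBaseSteinModel.lean`) inherit the trivial
multi-attachment of `Base g` (`exists_multiAttachmentData_isKasOpenBookOf_base`) and, by
`IsKasOpenBookOf.map`, its Kas open book.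

## References

* A. A. Kosinski, *Differential Manifolds*, Academic Press (1993), VI §6. [Kosinski1993]
-/

noncomputable section

open scoped Manifold ContDiff Topology
open Set Function

namespace Literature.Topology.FourManifolds

universe u

namespace HandleAttachingMap

variable {n k : ℕ} {M : Type u} [TopologicalSpace M] [T2Space M]
  [ChartedSpace (EuclideanHalfSpace (n + 1)) M]
  {ι : Type*} [Finite ι] {h : ι → HandleAttachingMap n k M}
  {EP HP : Type*} [NormedAddCommGroup EP] [NormedSpace ℝ EP] [TopologicalSpace HP]
  {IP : ModelWithCorners ℝ EP HP}
  {P : Type*} [TopologicalSpace P] [ChartedSpace HP P] [IsManifold IP ∞ P]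
  {P' : Type*} [TopologicalSpace P'] [ChartedSpace HP P'] [IsManifold IP ∞ P']

namespace MultiAttachmentData

/-- **Transport of multi-attachment data along a diffeomorphism of the target**: `P' ≅ P` is
again `M` with the handles attached, by `e ∘ jA` and `e ∘ jBᵢ`. [cite: Kosinski1993, VI §6] -/
def map (D : MultiAttachmentData h IP P) (e : P ≃ₘ⟮IP, IP⟯ P') : MultiAttachmentData h IP P' where
  disjoint := D.disjoint
  jA := e ∘ D.jA
  jB i := e ∘ D.jB i
  hjA := D.hjA.diffeomorph_comp e
  hjAo := by
    rw [range_comp]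
    exact e.toHomeomorph.isOpenMap _ D.hjAo
  hjB i := ⟨(D.hjB i).1.diffeomorph_comp e, by
    rw [range_comp]
    exact e.toHomeomorph.isOpenMap _ (D.hjB i).2⟩
  cover := by
    refine eq_univ_of_forall fun p => ?_
    rcases D.mem_range_or (e.symm p) with ⟨a, ha⟩ | ⟨i, b, hb⟩
    · exact Or.inl ⟨a, by simp [comp_apply, ha]⟩
    · exact Or.inr (mem_iUnion.2 ⟨i, b, by simp [comp_apply, hb]⟩)
  glue i a b := by
    rw [← D.glue i a b]
    exact e.injective.eq_iff
  disjointB i j hij := by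
    show Disjoint (range (e ∘ D.jB i)) (range (e ∘ D.jB j))
    rw [range_comp, range_comp]
    exact (Set.disjoint_image_iff e.injective).2 (D.disjointB hij)

/-- `(D.map e).jA = e ∘ D.jA`. [folklore] -/
@[simp] theorem map_jA (D : MultiAttachmentData h IP P) (e : P ≃ₘ⟮IP, IP⟯ P') :
    (D.map e).jA = e ∘ D.jA := rfl

/-- `(D.map e).jB i = e ∘ D.jB i`. [folklore] -/
@[simp] theorem map_jB (D : MultiAttachmentData h IP P) (e : P ≃ₘ⟮IP, IP⟯ P') (i : ι) :
    (D.map e).jB i = e ∘ D.jB i := rfl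

/-- Pointwise form: `(D.map e).jA a = e (D.jA a)`. [folklore] -/
theorem map_jA_apply (D : MultiAttachmentData h IP P) (e : P ≃ₘ⟮IP, IP⟯ P')
    (a : ↥(coresComplement h)) : (D.map e).jA a = e (D.jA a) := rfl

end MultiAttachmentData

end HandleAttachingMap

end Literature.Topology.FourManifolds

end
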